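import Summits.CriticalPhenomena.Ising3DConformalLimit.Theorems.HyperoctahedralRPExistsScaleCovariantLimitSplitGlue
import Summits.CriticalPhenomena.Ising3DConformalLimit.Theorems.HyperoctahedralRPExistsScaleCovariantLimitFunnelThroughDoubling
import Summits.CriticalPhenomena.Ising3DConformalLimit.Theses.TauBallRounding
import HarnessLib

/-!
# Split of crux `ExistsScaleCovariantLimit` (item stmt-CriticalPhenomena-1981) at route `TauBallRounding`'s copy —
# BC2-redirect assembly, crux-strategist r1 (planner-cstrat-stmt-CriticalPhenomena-1981-r1-0, 2026-08-17)

The typed decomposition (k = 2) of the shared existence crux `X = ExistsScaleCovariantLimit` into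
`X₁ = MirrorHoelderCompactness.TwoPointDoubling` (item stmt-CriticalPhenomena-6150 verbatim; the compactness half) and
`X₂ = ClusterRigidity.ClusterSetTotallyDisconnected` (item stmt-CriticalPhenomena-4659 verbatim; the identification half),
stated for route `TauBallRounding`'s copy of the shared decl BY NAME. All three route copies (`HyperoctahedralRP`,
`PositivityBegetsConformality`, `TauBallRounding`) have byte-identical bodies, so the landed `HyperoctahedralRP`-typed
terms are accepted here by `δ`-unfolding (`Iff.rfl`).

* `ExistsScaleCovariantLimit_of_subs : X₁ → X₂ → TauBallRounding.ExistsScaleCovariantLimit` — THE ASSEMBLY (proved; one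
  line over the landed standalone glue `SplitGlue.hrp_crux_of_doubling_of_totallyDisconnected`, p154899, itself the `←`
  half of the landed exactness theorem `FoldedCurrentRepulsion.crux_iff_doubling_and_totallyDisconnected`, p139907).
* `ExistsScaleCovariantLimit_iff_subs : X ↔ X₁ ∧ X₂` — the split is EXACT.
* `subs_of_existsScaleCovariantLimit`, `twoPointDoubling_of_crux`, `not_crux_of_not_twoPointDoubling`,
  `not_crux_of_not_totallyDisconnected` — necessity / contrapositives (refuting either child refutes the crux).
* `summit_of_items` — the HONEST RESIDUAL of route `TauBallRounding`: its deciding theorem `closes` with the crux replaced by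
  the two children: (T1) MonotoneRounding, (T2) RoundEndpoint, (B) RoundnessTransfer, 6150, 4659, (D) InversionUpgradeNormalised,
  (E) IsingEuclidUpgradeR4NonGaussian ⟹ `Ising3DConformalLimit`.

No statement is weakened or strengthened; everything is composition of landed theorems; no `sorry`.
References: H. Duminil-Copin, ICM 2022 §8.4 [DuminilCopinICM2022]; M. Aizenman, H. Duminil-Copin, Ann. of Math. 194 (2021),
arXiv:1912.07973, Remark 5.10 [AizenmanDuminilCopinAnnals2021].
-/

noncomputable section

namespace Summit.CriticalPhenomena.Ising3DConformalLimit.Cruxes.ExistsScaleCovariantLimit.TauBallRoundingSplit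

open Summit.CriticalPhenomena.Ising3DConformalLimit.Theses
open Summit.CriticalPhenomena.Ising3DConformalLimit.Cruxes.ExistsScaleCovariantLimit

/-- The route copy of the shared crux is the `HyperoctahedralRP` copy (same body). [folklore] -/
theorem crux_iff_hrp :
    TauBallRounding.ExistsScaleCovariantLimit ↔ HyperoctahedralRP.ExistsScaleCovariantLimit :=
  Iff.rfl

/-- **THE ASSEMBLY of the split (BC2 redirect, k = 2)**: item 6150 `TwoPointDoubling` and item 4659
`ClusterSetTotallyDisconnected` imply route `TauBallRounding`'s crux `ExistsScaleCovariantLimit` by name.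
[cite: AizenmanDuminilCopinAnnals2021, arXiv:1912.07973 Remark 5.10] -/
theorem ExistsScaleCovariantLimit_of_subs :
    MirrorHoelderCompactness.TwoPointDoubling → ClusterRigidity.ClusterSetTotallyDisconnected →
      TauBallRounding.ExistsScaleCovariantLimit :=
  SplitGlue.hrp_crux_of_doubling_of_totallyDisconnected

/-- **Exactness of the split**: the crux ⟺ item 6150 ∧ item 4659. [cite: DuminilCopinICM2022, §8.4 p. 29] -/
theorem ExistsScaleCovariantLimit_iff_subs :
    TauBallRounding.ExistsScaleCovariantLimit ↔
      MirrorHoelderCompactness.TwoPointDoubling ∧ ClusterRigidity.ClusterSetTotallyDisconnected :=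
  crux_iff_hrp.trans FoldedCurrentRepulsion.crux_iff_doubling_and_totallyDisconnected

/-- Necessity: the crux gives both children. [folklore] -/
theorem subs_of_existsScaleCovariantLimit (h : TauBallRounding.ExistsScaleCovariantLimit) :
    MirrorHoelderCompactness.TwoPointDoubling ∧ ClusterRigidity.ClusterSetTotallyDisconnected :=
  ExistsScaleCovariantLimit_iff_subs.1 h

/-- The crux forces the open all-scale axis doubling (item 6150). [cite: AizenmanDuminilCopinAnnals2021, arXiv:1912.07973 Remark 5.10] -/
theorem twoPointDoubling_of_crux (h : TauBallRounding.ExistsScaleCovariantLimit) :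
    MirrorHoelderCompactness.TwoPointDoubling :=
  Funnel.twoPointDoubling_of_crux (crux_iff_hrp.1 h)

/-- Contrapositive: a refutation of item 6150 refutes the crux. [folklore] -/
theorem not_crux_of_not_twoPointDoubling (h : ¬ MirrorHoelderCompactness.TwoPointDoubling) :
    ¬ TauBallRounding.ExistsScaleCovariantLimit :=
  fun h' => h (twoPointDoubling_of_crux h')

/-- Contrapositive: a refutation of item 4659 refutes the crux. [folklore] -/
theorem not_crux_of_not_totallyDisconnected (h : ¬ ClusterRigidity.ClusterSetTotallyDisconnected) :
    ¬ TauBallRounding.ExistsScaleCovariantLimit :=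
  fun h' => h (subs_of_existsScaleCovariantLimit h').2

/-- **The honest residual of route `TauBallRounding`** after the split: the deciding theorem `closes` with crux (C) replaced
by its two children. [cite: DuminilCopinICM2022, §8.4 p. 29] -/
theorem summit_of_items (hT1 : TauBallRounding.MonotoneRounding) (hT2 : TauBallRounding.RoundEndpoint)
    (hB : TauBallRounding.RoundnessTransfer)
    (hD : MirrorHoelderCompactness.TwoPointDoubling) (hTD : ClusterRigidity.ClusterSetTotallyDisconnected)
    (hInv : TauBallRounding.InversionUpgradeNormalised) (hNG : TauBallRounding.IsingEuclidUpgradeR4NonGaussian) :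
    _root_.Ising3DConformalLimit :=
  TauBallRounding.closes hT1 hT2 hB (ExistsScaleCovariantLimit_of_subs hD hTD) hInv hNG

end Summit.CriticalPhenomena.Ising3DConformalLimit.Cruxes.ExistsScaleCovariantLimit.TauBallRoundingSplit

end
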